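import Literature.MathematicalPhysics.QuantumFieldTheory.Balaban1983to89.T3AlphaInputsACTwoRunLevel
import Literature.MathematicalPhysics.QuantumFieldTheory.Balaban1983to89.T3Thresholds
import Summits.QuantumFields.YangMills.Theorems.AlphaInputsT3ACv3

/-!
# Crux-ideate sketch g12 (ideator 1, TRANSFER lens; stmt-QuantumFields-19201 / live twin stmt-QuantumFields-19935) — F-idea1-g12-1:
# the K1a KERNEL-MATCHING INTERFACE typed over the lane's OWN chart calculus (`jet26` / `iteratedFDeriv`), its composition to the local slack row
# `PolymerCauchyMinAtTSlack` (⇒ g11's `globalTwoRunSlackTail_of_polymerSlack` ⇒ the tail of the ruled STUB 3⁗ by name), and the DISPLAY AUDIT of `PkgAtV3`: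
# which (α)-side objects the interface reads, which of them `StepSeries` displays, and which it does not (deliverable (ii) of the deferred pen ★ym-ust-19935-slack,
# ARRIVAL-BRIEF-R282 / OWNER SWEEP 2026-08-27T10:51Z, pre-typed).

§0 carriers.  A CHART FAMILY `Φ K b Y : (PBond (F.P K) b → 𝕍) → ℂ` (run `K`, chart index `b` = the bond level of the chart variable, domain `Y`; the terms it
carries are the socket's term level `1 + b`), its FLAT KERNELS `ker Φ K b Y d := iteratedFDeriv ℂ d (Φ K b Y) 0` (the lane's `jet26` coefficients — `d`-linear maps,
colour NOT suppressed), the bond transport `transport : (PBond (F.P K) b → 𝕍) →L[ℂ] (PBond (F.P (K+1)) (b+1) → 𝕍)` along `matchBond` and the TRANSPORTED KERNEL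
`kerT` of run `K+1` pulled back to run `K`'s chart space; configuration family `B K k b Y W`, vacuum constants `e K b Y`, remainders `R K k b Y W`.
§1 the local slack row (verbatim g9/g10/g11 `PolymerCauchyMinAtTSlack`).  §2 the rows: `TaylorSplitΦ` (term = e + Re jet26(Φ)(B) + R — print's (30)/(33)/(43)),
`FlatKernelCauchyΦ` (K1a in operator norm: ‖kerT − ker‖ ≤ C e^{−κ𝓛}(L^{−(1+b)})^a — THE UNPRINTED NUMBER COMPARISON, [King1986] Prop. 3.6 for SU(2) d = 3),
`KernelSizeΦ` ((34)-type; DERIVABLE from the displayed `chart` row G3D-01 by Cauchy estimates + polarisation, d ≤ 6), `CfgSizeΦ`/`CfgCauchyΦ` (card 8/card 5 in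
chart currency, sup norm), `RemainderSmallΦ` ((57) + far terms G3D-06).  §3 the algebra, PROVED: `per_order_ml` (‖Kt(B₁^d) − K(B₀^d)‖ via
`ContinuousMultilinearMap.le_opNorm` + `norm_image_sub_le`), `taylor_core_ml`, and **`polymerCauchyMinAtTSlack_of_charts`** (the six rows ⟹ the slack row with
`σ = 7`, shifts `c := e′ − e` = the difference of the vacuum constants, constant `5(C_s²C + 6C_sC_BC_E) + 2C_R`) — proved via the WEIGHTED form
`polymerCauchyMinAtTSlackW_of_charts`: the configuration Cauchy row carries a LOSS `ℓ(n) ≥ 1` (`ℓ ≡ 1` = row of record; `ℓ(n) = L^{n/2}` = [King1986]'s per-site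
loss located at the two runs' background comparison (3.72) p.665, OWNER RULING g20-№11 ADDENDUM 2) and the output is `PolymerCauchyMinAtTSlackW … (w n := θ(n)²ℓ(n))`
(`slackW_theta_iff`: `w = θ²` is the row of record by `Iff.rfl`; `slackW_mono`: `θ(n)²ℓ(n) ≤ L^{βn}` opens the door to `GlobalSlackBeta.GlobalSupRateTSlackB` — OPTIONAL generality
per RULING №11 ADDENDUM 3).  §3c PURE-FIRST (ADDENDUM 3, of record; r2, append-only): `PolySplitΦ` (`R ≡ 0`), `jet_re_diff_ml`, **`polymerCauchyMinAtT_of_charts`** (five rows ⟹ the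
socket's PURE row `PolymerCauchyMinAtT D PT b₀ p₀ κ a (5(C_s²C + 6C_sC_BC_E))` BY NAME), `taylorSplit_of_polySplit`.  §4 THE DISPLAY AUDIT, typed over one run's
step data `𝔖 : ∀ k, StepSeries S G 𝕍 (N k) k` (instantiated by `fun k => (p K).𝔖 k` of a v3 family `p` in `FactorsThrough`), in the lane's own 𝓗-currency
(chart variable = `StepSeries`'s `𝓗 ∈ (PBond S.P b → 𝕍)` at every level): `ChartsDisplayed` (D1: the chart family IS the displayed `Ψ` — K1a is a statement
about the displayed `Ψ`'s of the two runs at matched steps), `BirthCfgDisplayed` (D2: the birth-level configurations ARE the displayed `Bcfg`, sized by the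
displayed (28) `bound28`), `birth_jet_eq` (the literal bridge `hPY` ↦ `TaylorSplitΦ` at the birth level, proved), `OldTermsAreBirthJets` (M1 = R-OLDFAC: the
previous-scale terms `oldVal` ARE the birth jets re-read at the transported configurations — NOT displayed: `oldVal` is value-only data with (44) `h44` + degree
floor `hfloor`; THE load-bearing gap — at lattice level `K−n` every term level but the top one is old).  REPORT (first-class outcome, ARRIVAL-BRIEF (ii)), in
one sentence: the K1a interface reads `Ψ` (displayed), `Bcfg` (displayed), `UkH` (displayed) and ONE object `StepSeries` does not display — (M1); besides, (M3)
the old-step configurations `Bof K k b` (`k > b+1`) are DEFINABLE from `UkH` + [7]'s chart map + (27) (a definition, not a gap; their two-run row `CfgCauchyΦ`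
is the 19200-side [7]/F4 content), and (M4) canonicity across `K` (F-g4-1/N-g4-2, known): K1a is a row about ONE chart family for all `K`, so the `∃ p` of 3⁗ is
discharged only by a family with `FactorsThrough p Φ …` — a CONSTRUCTION, not obtainable from `OfV3At`; a two-run data schema must carry (M1) and K1a.
CONCORDANCE (read after typing; same located gap, three readings): ideator 2's FINDING N8 R0 (`Sketch_ideator2_g11`, 11:25Z: print's (43) kernels `𝒫_j(Y)` and
loop-variable maps `B_k(c)` as record FIELDS + the exact structure row, B-currency, `R ≡ 0`) and lit g13 L-24 (g) (11:13Z: (33)–(34) p.264 / (43) p.266 are the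
print warrant; in the `TermFn` currency of record the kernel family and the pairing are not displayed) locate the SAME object; this file's delta: in the lane's
𝓗-currency NO new kernel FIELD is needed (kernels = `iteratedFDeriv` of the displayed `Ψ`), the one missing ROW is (M1) for `oldVal`, the rest `R` is the displayed
`far` (G3D-06) — so the `θ(n)^σ` slack is not idle in this currency: it absorbs the far terms' two-run difference uncompared — and the composition is checked in
operator-norm multilinear calculus with colour kept.  Nothing of [Balaban1985UV3]/[King1986] is asserted; 0 sorry.

References: C. King, CMP 102 (1986) 649–677 [King1986] (Thm 3.4 (3.9) p.656, (3.42) p.660, Prop. 3.6 (3.55)–(3.57) p.662, Props 3.8–3.9 (3.71)–(3.75) p.665, §4); T. Bałaban, CMP 102 (1985) 255–275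
[Balaban1985UV3] ((27)–(30) p.263, (32)–(34) p.264, (43)–(44) pp.266–267, (57) p.270); T. Bałaban, CMP 102 (1985) 277–309 [Balaban1985Variational]
((158) p.302, Prop. 9 p.309).
-/

set_option autoImplicit false

noncomputable section

open scoped BigOperators
open Literature.MathematicalPhysics.QuantumFieldTheory.Balaban1983to89
open Literature.MathematicalPhysics.QuantumFieldTheory.Balaban1983to89.T3ContinuumYM3Torus
open Literature.MathematicalPhysics.QuantumFieldTheory.Balaban1983to89.T3UnitScaleTilt
open Literature.MathematicalPhysics.QuantumFieldTheory.Balaban1983to89.T3LevelShift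
open Literature.MathematicalPhysics.QuantumFieldTheory.Balaban1983to89.T3AlphaInputsAC
open Literature.MathematicalPhysics.QuantumFieldTheory.Balaban1983to89.T3AlphaPolymerSocket
open Literature.MathematicalPhysics.QuantumFieldTheory.Balaban1983to89.T3AlphaInputsACTwoRun
open Literature.MathematicalPhysics.QuantumFieldTheory.Balaban1983to89.T3AlphaInputsACTwoRunLevel
open Literature.MathematicalPhysics.QuantumFieldTheory.Balaban1983to89.TreeLengthTorus (tsys)
open Literature.MathematicalPhysics.QuantumFieldTheory.Balaban1985CMP102
open Literature.MathematicalPhysics.QuantumFieldTheory.Balaban1985CMP102.Setting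
open Summit.QuantumFields.Balaban3D.Carriers
open Summit.QuantumFields.Balaban3D.Proofs.Primitives
open Summit.QuantumFields.Balaban3D.Proofs.GroupModelLieC (lieC)
open Summit.QuantumFields.Balaban3D.Proofs.Representation33 (jet26)
open Summit.QuantumFields.YangMills.Theorems

namespace Summit.QuantumFields.YangMills.Cruxes.FluctuationComparisonRegPr.Ideate1ChartKernels

/-! ## §0 Carriers: chart families, flat kernels, bond transport -/

/-- The bond matching of the two runs (level `b` of run `K` ≃ level `b+1` of run `K+1`; `T3LevelShift.bondShift`). [cite: Balaban1987RG1, (0.1) p.251] -/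
def matchBond (F : T3Family) (K b : ℕ) : PBond (F.P K) b ≃ PBond (F.P (K + 1)) (b + 1) :=
  bondShift (F.sitesPerDir_eq (m := F.m) (K := K) (j := b) (m' := F.m) (K' := K + 1) (j' := b + 1) (by omega))

/-- CHART FAMILY: run `K`, chart index `b` (the bond level of the chart variable; the terms are print's `𝒫_{b+1}`, the socket's term level `1 + b`), domain
`Y` ↦ an analytic chart on the configuration space `PBond (F.P K) b → 𝕍` (the lane's `StepSeries.Ψ` at step `b`, in its own 𝓗-currency; §4 (D1)).
[cite: Balaban1985UV3, (29)-(30) p.263, (33) p.264] -/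
abbrev ChartFam (𝕍 : Type) (F : T3Family) : Type :=
  (K b : ℕ) → Set (Site (F.P K) 0) → ((PBond (F.P K) b → 𝕍) → ℂ)

/-- CONFIGURATION FAMILY: run `K`, lattice level `k`, chart index `b`, domain `Y`, level-`k` field `W` ↦ the chart configuration at which the level-`(1+b)` terms are
read (`𝓗_b(B_{b+1})|_Y` of the level-`k` composite minimiser at the trivial history; at `k = b+1` the displayed `Bcfg`, §4 (D2)). [cite: Balaban1985UV3, (27) p.263, (43) p.266] -/
abbrev CfgFam (𝕍 : Type) (F : T3Family) : Type :=
  (K k b : ℕ) → Set (Site (F.P K) 0) → GaugeField (F.P K) k (Matrix.specialUnitaryGroup (Fin 2) ℂ) → (PBond (F.P K) b → 𝕍)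

/-- VACUUM CONSTANTS `𝒫′(g, Y, 1)` (order 0 of (30); field-independent). [cite: Balaban1985UV3, (30)-(31) p.263] -/
abbrev VacFam (F : T3Family) : Type := (K b : ℕ) → Set (Site (F.P K) 0) → ℝ

/-- REMAINDERS (order ≥ 7 of (30)/(57) and the far terms G3D-06, read at a level-`k` field). [cite: Balaban1985UV3, (57) p.270] -/
abbrev RemFam (F : T3Family) : Type :=
  (K k b : ℕ) → Set (Site (F.P K) 0) → GaugeField (F.P K) k (Matrix.specialUnitaryGroup (Fin 2) ℂ) → ℝ

section Kernels

variable {𝕍 : Type} [NormedAddCommGroup 𝕍] [NormedSpace ℂ 𝕍] {F : T3Family}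

/-- **FLAT KERNEL** of order `d` of the chart `Φ K b Y`: its `d`-th Fréchet derivative at the flat point `0` — the coefficient `d`-linear map of `jet26`
(`jet26 Ψ B = Σ_{d=2}^{6} (d!)⁻¹ • ker(B, …, B)`), a FIELD-INDEPENDENT object ([King1986] (3.55): graphs with the fields pulled out). [cite: King1986, (3.55) p.662] -/
def ker (Φ : ChartFam 𝕍 F) (K b : ℕ) (Y : Set (Site (F.P K) 0)) (d : ℕ) :
    ContinuousMultilinearMap ℂ (fun _ : Fin d => PBond (F.P K) b → 𝕍) ℂ :=
  iteratedFDeriv ℂ d (Φ K b Y) 0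

variable (𝕍) in
/-- BOND TRANSPORT of configurations from run `K` (chart index `b`) to run `K+1` (chart index `b+1`) along `matchBond` (re-indexing; a linear isometry of the sup
norms). [cite: Balaban1987RG1, (0.1) p.251] -/
def transport (F : T3Family) (K b : ℕ) : (PBond (F.P K) b → 𝕍) →L[ℂ] (PBond (F.P (K + 1)) (b + 1) → 𝕍) :=
  ContinuousLinearMap.pi fun c' => ContinuousLinearMap.proj ((matchBond F K b).symm c')

theorem transport_apply (K b : ℕ) (x : PBond (F.P K) b → 𝕍) (c' : PBond (F.P (K + 1)) (b + 1)) :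
    transport 𝕍 F K b x c' = x ((matchBond F K b).symm c') := rfl

/-- The transport of the pull-back of a run-`(K+1)` configuration is that configuration. [folklore] -/
theorem transport_pullback (K b : ℕ) (x' : PBond (F.P (K + 1)) (b + 1) → 𝕍) :
    transport 𝕍 F K b (fun c => x' (matchBond F K b c)) = x' := by
  funext c'
  rw [transport_apply]
  exact congrArg x' ((matchBond F K b).apply_symm_apply c')

/-- **TRANSPORTED KERNEL**: the order-`d` flat kernel of run `K+1` at `(b+1, refineSet Y)` pulled back to run `K`'s chart space along the bond matching.
[cite: King1986, Prop. 3.6 (3.56) p.662] -/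
def kerT (Φ : ChartFam 𝕍 F) (K b : ℕ) (Y : Set (Site (F.P K) 0)) (d : ℕ) :
    ContinuousMultilinearMap ℂ (fun _ : Fin d => PBond (F.P K) b → 𝕍) ℂ :=
  (ker Φ (K + 1) (b + 1) (refineSet F K Y) d).compContinuousLinearMap fun _ => transport 𝕍 F K b

theorem kerT_apply_const (Φ : ChartFam 𝕍 F) (K b : ℕ) (Y : Set (Site (F.P K) 0)) (d : ℕ) (x : PBond (F.P K) b → 𝕍) :
    kerT Φ K b Y d (fun _ => x) = ker Φ (K + 1) (b + 1) (refineSet F K Y) d (fun _ => transport 𝕍 F K b x) := by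
  simp [kerT, ContinuousMultilinearMap.compContinuousLinearMap_apply]

end Kernels

/-! ## §1 The local slack row (verbatim g9/g10/g11) -/

section Rows

variable {𝕍 : Type} [NormedAddCommGroup 𝕍] [NormedSpace ℂ 𝕍] {F : T3Family} {γ : ℝ}

/-- **THE TWO-CUT-OFF ROW WITH AN ADDITIVE SLACK** (`PolymerCauchyMinAtT` + `C·e^{−κ₁𝓛}·L^{−4(K−n−1−j)}·θ(n)^σ`; g9 §1, g10/g11 verbatim; consumed by g11's
`globalTwoRunSlackTail_of_polymerSlack` ⇒ `GlobalSupRateTSlack` = the tail of STUB 3⁗). [cite: King1986, Thm 3.4 (3.9) p.656] -/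
def PolymerCauchyMinAtTSlack (D : AlphaDataT3 F γ) (PT : TermFn F) (b₀ p₀ κ₁ a : ℝ) (σ : ℕ) (C : ℝ) : Prop :=
  ∃ c : (K n j : ℕ) → Set (Site (F.P K) 0) → ℝ,
    ∀ (K n : ℕ) (h : n ≤ K), ∀ j : ℕ, j < K - n →
      ∀ V : GaugeField (F.P n) 0 (Matrix.specialUnitaryGroup (Fin 2) ℂ), PlaqSmall (θBal F.L γ b₀ p₀ n) V →
        ∀ Y ∈ D.Loc K (K - n) (D.triv K (K - n)) (1 + j),
          |PT (K + 1) (K + 1 - n) (1 + (j + 1)) (refineSet F K Y)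
              (fieldShift (F.sitesPerDir_eq (m := F.m) (K := K + 1) (j := K + 1 - n) (m' := F.m) (K' := n) (j' := 0) (by omega)) V) -
            PT K (K - n) (1 + j) Y
              (fieldShift (F.sitesPerDir_eq (m := F.m) (K := K) (j := K - n) (m' := F.m) (K' := n) (j' := 0) (by omega)) V) -
            c K n j Y| ≤
          C * Real.exp (-κ₁ * D.treeLen K (1 + j) Y) * (((F.L : ℝ) ^ (K - n - 1 - j))⁻¹) ^ 4 *
            (θBal F.L γ b₀ p₀ n ^ 2 * (((F.L : ℝ) ^ (1 + j))⁻¹) ^ a + θBal F.L γ b₀ p₀ n ^ σ)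

/-- **THE LOCAL SLACK ROW WITH A GENERAL RATE WEIGHT** `w n` in place of `θ(n)²` (for the β-door of OWNER RULING g20-№11 ADDENDUM 2: [King1986] (3.42) p.660
prints the rate term with the per-site loss `(L^kε)^{−1/2}`, located at the configuration comparison (3.72) p.665; `w n := θ(n)²·ℓ(n)` with a loss `ℓ(n) ≥ 1`,
e.g. `L^{n/2}`, `θ(n)²ℓ(n) ≤ L^{βn}`).  `w n := θ(n)²` is the row of record VERBATIM (`slackW_theta_iff`). [cite: King1986, (3.42) p.660, (3.72) p.665] -/
def PolymerCauchyMinAtTSlackW (D : AlphaDataT3 F γ) (PT : TermFn F) (b₀ p₀ κ₁ a : ℝ) (σ : ℕ) (C : ℝ) (w : ℕ → ℝ) : Prop :=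
  ∃ c : (K n j : ℕ) → Set (Site (F.P K) 0) → ℝ,
    ∀ (K n : ℕ) (h : n ≤ K), ∀ j : ℕ, j < K - n →
      ∀ V : GaugeField (F.P n) 0 (Matrix.specialUnitaryGroup (Fin 2) ℂ), PlaqSmall (θBal F.L γ b₀ p₀ n) V →
        ∀ Y ∈ D.Loc K (K - n) (D.triv K (K - n)) (1 + j),
          |PT (K + 1) (K + 1 - n) (1 + (j + 1)) (refineSet F K Y)
              (fieldShift (F.sitesPerDir_eq (m := F.m) (K := K + 1) (j := K + 1 - n) (m' := F.m) (K' := n) (j' := 0) (by omega)) V) -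
            PT K (K - n) (1 + j) Y
              (fieldShift (F.sitesPerDir_eq (m := F.m) (K := K) (j := K - n) (m' := F.m) (K' := n) (j' := 0) (by omega)) V) -
            c K n j Y| ≤
          C * Real.exp (-κ₁ * D.treeLen K (1 + j) Y) * (((F.L : ℝ) ^ (K - n - 1 - j))⁻¹) ^ 4 *
            (w n * (((F.L : ℝ) ^ (1 + j))⁻¹) ^ a + θBal F.L γ b₀ p₀ n ^ σ)

/-- The row of record is the weighted row at `w n = θ(n)²` (definitional). [folklore] -/
theorem slackW_theta_iff (D : AlphaDataT3 F γ) (PT : TermFn F) (b₀ p₀ κ₁ a : ℝ) (σ : ℕ) (C : ℝ) :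
    PolymerCauchyMinAtTSlackW D PT b₀ p₀ κ₁ a σ C (fun n => θBal F.L γ b₀ p₀ n ^ 2) ↔ PolymerCauchyMinAtTSlack D PT b₀ p₀ κ₁ a σ C :=
  Iff.rfl

/-- A larger weight is a weaker row (e.g. `θ(n)²·ℓ(n) ≤ L^{βn}` for the β-form). [folklore] -/
theorem slackW_mono {D : AlphaDataT3 F γ} {PT : TermFn F} {b₀ p₀ κ₁ a : ℝ} {σ : ℕ} {C : ℝ} {w w' : ℕ → ℝ} (hC : 0 ≤ C)
    (hw : ∀ n, w n ≤ w' n) (h : PolymerCauchyMinAtTSlackW D PT b₀ p₀ κ₁ a σ C w) : PolymerCauchyMinAtTSlackW D PT b₀ p₀ κ₁ a σ C w' := by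
  obtain ⟨c, hc⟩ := h
  refine ⟨c, fun K n hn j hj V hV Y hY => (hc K n hn j hj V hV Y hY).trans ?_⟩
  have hP : 0 ≤ C * Real.exp (-κ₁ * D.treeLen K (1 + j) Y) * (((F.L : ℝ) ^ (K - n - 1 - j))⁻¹) ^ 4 :=
    mul_nonneg (mul_nonneg hC (Real.exp_pos _).le) (by positivity)
  have hρ : 0 ≤ (((F.L : ℝ) ^ (1 + j))⁻¹) ^ a := Real.rpow_nonneg (by positivity) _
  exact mul_le_mul_of_nonneg_left (add_le_add (mul_le_mul_of_nonneg_right (hw n) hρ) le_rfl) hP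

/-! ## §2 The rows of the K1a interface (chart calculus) -/

/-- **STRUCTURE ROW (Taylor form, chart calculus)**: the level-`(1+b)` term on `Y` read at a level-`k` field = vacuum constant + the order-2…6 jet of the chart
`Φ K b Y` at the configuration `B K k b Y W` (real part) + remainder.  For a coherent family this is `hPY`/`hPYZ` at the birth level and R-OLDFAC (§4) at the old
levels. [cite: Balaban1985UV3, (30) p.263, (33) p.264, (43) p.266, (57) p.270] -/
def TaylorSplitΦ (PT : TermFn F) (Φ : ChartFam 𝕍 F) (e : VacFam F) (B : CfgFam 𝕍 F) (R : RemFam F) : Prop :=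
  ∀ (K k b : ℕ) (Y : Set (Site (F.P K) 0)) (W : GaugeField (F.P K) k (Matrix.specialUnitaryGroup (Fin 2) ℂ)),
    PT K k (1 + b) Y W = e K b Y + (jet26 (Φ K b Y) (B K k b Y W)).re + R K k b Y W

/-- **K1a — FLAT-KERNEL CAUCHY ROW in operator norm (the unprinted NUMBER comparison; [King1986] Prop. 3.6 (3.56) for SU(2), d = 3)**: for `2 ≤ d ≤ 6` the
transported order-`d` kernel of run `K+1` at `(b+1, refineSet Y)` and the order-`d` kernel of run `K` at `(b, Y)` differ by `C·e^{−κ𝓛_K(Y)}·(L^{−(1+b)})^a` —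
ONE chart family `Φ` for all `K` (canonicity, F-g4-1). [cite: King1986, Prop. 3.6 (3.56) p.662, Prop. 3.9 (3.74) p.665] -/
def FlatKernelCauchyΦ (D : AlphaDataT3 F γ) (Φ : ChartFam 𝕍 F) (κ a C : ℝ) : Prop :=
  ∀ (K k b : ℕ) (Y : Set (Site (F.P K) 0)), Y ∈ D.Loc K k (D.triv K k) (1 + b) →
    ∀ d ∈ Finset.Ico 2 7,
      ‖kerT Φ K b Y d - ker Φ K b Y d‖ ≤ C * Real.exp (-κ * D.treeLen K (1 + b) Y) * (((F.L : ℝ) ^ (1 + b))⁻¹) ^ a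

/-- **KERNEL SIZE ROW** (operator norm of the flat kernels; printed type (34) — derivable from the displayed analyticity row `chart` (G3D-01,
`ChartAnalyticityAsCited (Ψ X) ρ (C25·g_k·e^{−κ dj X})`) by Cauchy estimates and polarisation, `d ≤ 6`, radius absorbed). [cite: Balaban1985UV3, Prop. 3 (34) p.264] -/
def KernelSizeΦ (D : AlphaDataT3 F γ) (Φ : ChartFam 𝕍 F) (κ C_E : ℝ) : Prop :=
  ∀ (K k b : ℕ) (Y : Set (Site (F.P K) 0)), Y ∈ D.Loc K k (D.triv K k) (1 + b) →
    ∀ d ∈ Finset.Ico 2 7, ‖ker Φ K b Y d‖ ≤ C_E * Real.exp (-κ * D.treeLen K (1 + b) Y)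

/-- **REMAINDER ROW** (the rest `R` of `TaylorSplitΦ`, both runs): in the lane's currency `R` at the birth level is MINUS the displayed far terms (`hPY`:
`PY = Σ_X (jet26 Ψ_X (Bcfg X)).re − far X`), sized by the displayed row `far_le` (G3D-06, `Cfar·g_b⁷(r p)⁷`-small) — so this row is DERIVABLE there (up to the
polylogarithm-into-power absorption of ideator 2's N8 §1–§2); at the old levels it is the `Rfar` of (M1).  Level factor `x⁴` only (order-≥2 monomials with one
far leg), not `x¹⁴`. [cite: Balaban1985UV3, (57) p.270, p.264 L15-16] -/
def RemainderSmallΦ (D : AlphaDataT3 F γ) (R : RemFam F) (b₀ p₀ κ C_R : ℝ) : Prop :=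
  ∀ (K n : ℕ) (h : n ≤ K), ∀ j : ℕ, j < K - n →
    ∀ V : GaugeField (F.P n) 0 (Matrix.specialUnitaryGroup (Fin 2) ℂ), PlaqSmall (θBal F.L γ b₀ p₀ n) V →
      ∀ Y ∈ D.Loc K (K - n) (D.triv K (K - n)) (1 + j),
        |R K (K - n) j Y
            (fieldShift (F.sitesPerDir_eq (m := F.m) (K := K) (j := K - n) (m' := F.m) (K' := n) (j' := 0) (by omega)) V)| ≤
          C_R * Real.exp (-κ * D.treeLen K (1 + j) Y) * θBal F.L γ b₀ p₀ n ^ 7 * (((F.L : ℝ) ^ (K - n - 1 - j))⁻¹) ^ 4 ∧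
        |R (K + 1) (K + 1 - n) (j + 1) (refineSet F K Y)
            (fieldShift (F.sitesPerDir_eq (m := F.m) (K := K + 1) (j := K + 1 - n) (m' := F.m) (K' := n) (j' := 0) (by omega)) V)| ≤
          C_R * Real.exp (-κ * D.treeLen K (1 + j) Y) * θBal F.L γ b₀ p₀ n ^ 7 * (((F.L : ℝ) ^ (K - n - 1 - j))⁻¹) ^ 4

/-- **CONFIGURATION SIZE ROW** (sup norm; card 8 `ChartCfgSize`; run `K+1`'s configuration pulled back along `matchBond`). [cite: Balaban1985UV3, (28) p.263, (44) p.267] -/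
def CfgSizeΦ (D : AlphaDataT3 F γ) (B : CfgFam 𝕍 F) (b₀ p₀ C_s : ℝ) : Prop :=
  ∀ (K n : ℕ) (h : n ≤ K), ∀ j : ℕ, j < K - n →
    ∀ V : GaugeField (F.P n) 0 (Matrix.specialUnitaryGroup (Fin 2) ℂ), PlaqSmall (θBal F.L γ b₀ p₀ n) V →
      ∀ Y ∈ D.Loc K (K - n) (D.triv K (K - n)) (1 + j),
        ‖B K (K - n) j Y
            (fieldShift (F.sitesPerDir_eq (m := F.m) (K := K) (j := K - n) (m' := F.m) (K' := n) (j' := 0) (by omega)) V)‖ ≤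
          C_s * θBal F.L γ b₀ p₀ n * (((F.L : ℝ) ^ (K - n - 1 - j))⁻¹) ^ 2 ∧
        ‖(fun c => B (K + 1) (K + 1 - n) (j + 1) (refineSet F K Y)
            (fieldShift (F.sitesPerDir_eq (m := F.m) (K := K + 1) (j := K + 1 - n) (m' := F.m) (K' := n) (j' := 0) (by omega)) V)
            (matchBond F K j c))‖ ≤
          C_s * θBal F.L γ b₀ p₀ n * (((F.L : ℝ) ^ (K - n - 1 - j))⁻¹) ^ 2

/-- **CONFIGURATION CAUCHY ROW WITH A LOSS `ℓ(n) ≥ 1`** (sup norm; card 8 `ChartCfgCauchy` = card 5 / stmt-19200 in chart currency — the 19200-side [7]/F4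
content; `ℓ ≡ 1` is the loss-free row of record, `ℓ(n) = L^{n/2}` is [King1986]'s located per-site loss at the two runs' background comparison (3.72) p.665,
OWNER RULING g20-№11 ADDENDUM 2). [cite: King1986, Prop. 3.9 (3.71) p.665, (3.72) p.665] -/
def CfgCauchyΦ (D : AlphaDataT3 F γ) (B : CfgFam 𝕍 F) (b₀ p₀ a C_B : ℝ) (ℓ : ℕ → ℝ) : Prop :=
  ∀ (K n : ℕ) (h : n ≤ K), ∀ j : ℕ, j < K - n →
    ∀ V : GaugeField (F.P n) 0 (Matrix.specialUnitaryGroup (Fin 2) ℂ), PlaqSmall (θBal F.L γ b₀ p₀ n) V →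
      ∀ Y ∈ D.Loc K (K - n) (D.triv K (K - n)) (1 + j),
        ‖(fun c => B (K + 1) (K + 1 - n) (j + 1) (refineSet F K Y)
              (fieldShift (F.sitesPerDir_eq (m := F.m) (K := K + 1) (j := K + 1 - n) (m' := F.m) (K' := n) (j' := 0) (by omega)) V)
              (matchBond F K j c)) -
            B K (K - n) j Y
              (fieldShift (F.sitesPerDir_eq (m := F.m) (K := K) (j := K - n) (m' := F.m) (K' := n) (j' := 0) (by omega)) V)‖ ≤
          C_B * θBal F.L γ b₀ p₀ n * (((F.L : ℝ) ^ (K - n - 1 - j))⁻¹) ^ 2 * (ℓ n * (((F.L : ℝ) ^ (1 + j))⁻¹) ^ a)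

end Rows

/-! ## §3 The algebra of the chart calculus (proved) -/

section Algebra

/-- **ONE ORDER**: `‖Kt(B₁,…,B₁) − K(B₀,…,B₀)‖ ≤ s²·‖Kt − K‖-budget + 6·s·t·‖K‖-budget` for `2 ≤ d ≤ 6`, `‖B₀‖, ‖B₁‖ ≤ s ≤ 1`, `‖B₁ − B₀‖ ≤ t`
(`ContinuousMultilinearMap.le_opNorm` + `norm_image_sub_le`). [cite: King1986, (3.56)-(3.57) p.662] -/
theorem per_order_ml {E : Type*} [NormedAddCommGroup E] [NormedSpace ℂ E] {d : ℕ} (hd2 : 2 ≤ d) (hd6 : d ≤ 6)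
    (Kr Kt : ContinuousMultilinearMap ℂ (fun _ : Fin d => E) ℂ) (B₀ B₁ : E)
    {s t e ρ C C_E : ℝ} (hs0 : 0 ≤ s) (hs1 : s ≤ 1) (ht : 0 ≤ t)
    (hB₀ : ‖B₀‖ ≤ s) (hB₁ : ‖B₁‖ ≤ s) (hΔ : ‖B₁ - B₀‖ ≤ t)
    (hK : ‖Kt - Kr‖ ≤ C * e * ρ) (hE : ‖Kr‖ ≤ C_E * e) :
    ‖Kt (fun _ => B₁) - Kr (fun _ => B₀)‖ ≤ s ^ 2 * (C * e * ρ) + 6 * s * t * (C_E * e) := by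
  have hKnn : 0 ≤ C * e * ρ := (norm_nonneg _).trans hK
  have hEnn : 0 ≤ C_E * e := (norm_nonneg _).trans hE
  have split : Kt (fun _ => B₁) - Kr (fun _ => B₀) =
      (Kt - Kr) (fun _ => B₁) + (Kr (fun _ => B₁) - Kr (fun _ => B₀)) := by
    rw [show (Kt - Kr) (fun _ => B₁) = Kt (fun _ => B₁) - Kr (fun _ => B₁) from rfl]; ring
  have h1 : ‖(Kt - Kr) (fun _ => B₁)‖ ≤ s ^ 2 * (C * e * ρ) := by
    calc ‖(Kt - Kr) (fun _ => B₁)‖ ≤ ‖Kt - Kr‖ * ∏ _l : Fin d, ‖B₁‖ := (Kt - Kr).le_opNorm _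
      _ = ‖Kt - Kr‖ * ‖B₁‖ ^ d := by rw [Finset.prod_const, Finset.card_univ, Fintype.card_fin]
      _ ≤ (C * e * ρ) * s ^ d := mul_le_mul hK (pow_le_pow_left₀ (norm_nonneg _) hB₁ d) (by positivity) hKnn
      _ ≤ (C * e * ρ) * s ^ 2 := mul_le_mul_of_nonneg_left (pow_le_pow_of_le_one hs0 hs1 hd2) hKnn
      _ = _ := by ring
  have h2 : ‖Kr (fun _ => B₁) - Kr (fun _ => B₀)‖ ≤ 6 * s * t * (C_E * e) := by
    have hle := Kr.norm_image_sub_le (fun _ : Fin d => B₁) (fun _ => B₀)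
    rw [Fintype.card_fin] at hle
    have hm : max ‖(fun _ : Fin d => B₁)‖ ‖(fun _ : Fin d => B₀)‖ ≤ s :=
      max_le ((pi_norm_const_le B₁).trans hB₁) ((pi_norm_const_le B₀).trans hB₀)
    have hm0 : 0 ≤ max ‖(fun _ : Fin d => B₁)‖ ‖(fun _ : Fin d => B₀)‖ := (norm_nonneg _).trans (le_max_left _ _)
    have hsub : ((fun _ : Fin d => B₁) - fun _ : Fin d => B₀) = fun _ => B₁ - B₀ := rfl
    have hdiff : ‖(fun _ : Fin d => B₁) - fun _ : Fin d => B₀‖ ≤ t := by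
      rw [hsub]; exact (pi_norm_const_le (B₁ - B₀)).trans hΔ
    have hA : ‖Kr‖ * (d : ℝ) ≤ C_E * e * 6 := mul_le_mul hE (by exact_mod_cast hd6) (Nat.cast_nonneg d) hEnn
    have hB : max ‖(fun _ : Fin d => B₁)‖ ‖(fun _ : Fin d => B₀)‖ ^ (d - 1) ≤ s ^ (d - 1) := pow_le_pow_left₀ hm0 hm (d - 1)
    have hsd : s ^ (d - 1) ≤ s := by
      have h' : s ^ (d - 1) ≤ s ^ 1 := pow_le_pow_of_le_one hs0 hs1 (by omega)
      rwa [pow_one] at h'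
    calc ‖Kr (fun _ => B₁) - Kr (fun _ => B₀)‖
        ≤ ‖Kr‖ * (d : ℝ) * max ‖(fun _ : Fin d => B₁)‖ ‖(fun _ : Fin d => B₀)‖ ^ (d - 1) *
            ‖(fun _ : Fin d => B₁) - fun _ : Fin d => B₀‖ := hle
      _ ≤ C_E * e * 6 * s ^ (d - 1) * t :=
          mul_le_mul (mul_le_mul hA hB (pow_nonneg hm0 _) (by positivity)) hdiff (norm_nonneg _) (by positivity)
      _ ≤ C_E * e * 6 * s * t := by
          have h6 : 0 ≤ C_E * e * 6 := by positivity
          exact mul_le_mul_of_nonneg_right (mul_le_mul_of_nonneg_left hsd h6) ht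
      _ = _ := by ring
  rw [split]
  exact (norm_add_le _ _).trans (add_le_add h1 h2)

/-- `‖(d!)⁻¹‖ ≤ 1` in `ℂ`. [folklore] -/
theorem norm_inv_factorial_le_one (d : ℕ) : ‖((d.factorial : ℂ))⁻¹‖ ≤ 1 := by
  rw [norm_inv, Complex.norm_natCast]
  exact inv_le_one_of_one_le₀ (by exact_mod_cast Nat.succ_le_of_lt (Nat.factorial_pos d))

/-- **THE TAYLOR CORE (orders 2..6 of `jet26` + vacuum constants + two remainders), chart calculus**: the composition of the six rows at one `(K, n, j, V, Y)`.
[cite: King1986, Prop. 3.6 (3.56)-(3.57) p.662; Balaban1985UV3, (30) p.263] -/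
theorem taylor_core_ml {E₀ E₁ : Type*} [NormedAddCommGroup E₀] [NormedSpace ℂ E₀] [NormedAddCommGroup E₁] [NormedSpace ℂ E₁]
    (T : E₀ →L[ℂ] E₁) (Ψ₀ : E₀ → ℂ) (Ψ₁ : E₁ → ℂ) (B₀ B₁ : E₀) (e₀ e₁ R₀ R₁ : ℝ)
    {θ x ρ e C C_E C_R C_s C_B : ℝ}
    (hθ : 0 ≤ θ) (hsθ : C_s * θ ≤ 1) (hx0 : 0 ≤ x) (hx1 : x ≤ 1) (hρ : 0 ≤ ρ) (he : 0 ≤ e)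
    (hC : 0 ≤ C) (hCE : 0 ≤ C_E) (hCR : 0 ≤ C_R) (hCs : 0 ≤ C_s) (hCB : 0 ≤ C_B)
    (hB₀ : ‖B₀‖ ≤ C_s * θ * x ^ 2) (hB₁ : ‖B₁‖ ≤ C_s * θ * x ^ 2) (hΔ : ‖B₁ - B₀‖ ≤ C_B * θ * x ^ 2 * ρ)
    (hK : ∀ d ∈ Finset.Ico 2 7,
      ‖(iteratedFDeriv ℂ d Ψ₁ 0).compContinuousLinearMap (fun _ => T) - iteratedFDeriv ℂ d Ψ₀ 0‖ ≤ C * e * ρ)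
    (hE : ∀ d ∈ Finset.Ico 2 7, ‖iteratedFDeriv ℂ d Ψ₀ 0‖ ≤ C_E * e)
    (hR₀ : |R₀| ≤ C_R * e * θ ^ 7 * x ^ 4) (hR₁ : |R₁| ≤ C_R * e * θ ^ 7 * x ^ 4) :
    |e₁ + (jet26 Ψ₁ (T B₁)).re + R₁ - (e₀ + (jet26 Ψ₀ B₀).re + R₀) - (e₁ - e₀)| ≤
      (5 * (C_s ^ 2 * C + 6 * C_s * C_B * C_E) + 2 * C_R) * e * x ^ 4 * (θ ^ 2 * ρ + θ ^ 7) := by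
  have hx2 : x ^ 2 ≤ 1 := pow_le_one₀ hx0 hx1
  have hs0 : 0 ≤ C_s * θ * x ^ 2 := by positivity
  have hs1 : C_s * θ * x ^ 2 ≤ 1 := by
    calc C_s * θ * x ^ 2 ≤ 1 * 1 := mul_le_mul hsθ hx2 (by positivity) zero_le_one
      _ = 1 := one_mul 1
  have ht0 : 0 ≤ C_B * θ * x ^ 2 * ρ := by positivity
  -- the jet difference, order by order
  have hper : ∀ d ∈ Finset.Ico 2 7,
      ‖iteratedFDeriv ℂ d Ψ₁ 0 (fun _ => T B₁) - iteratedFDeriv ℂ d Ψ₀ 0 (fun _ => B₀)‖ ≤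
        (C_s * θ * x ^ 2) ^ 2 * (C * e * ρ) + 6 * (C_s * θ * x ^ 2) * (C_B * θ * x ^ 2 * ρ) * (C_E * e) := by
    intro d hd
    have hd' := Finset.mem_Ico.mp hd
    have happ : iteratedFDeriv ℂ d Ψ₁ 0 (fun _ => T B₁) =
        ((iteratedFDeriv ℂ d Ψ₁ 0).compContinuousLinearMap fun _ => T) (fun _ => B₁) := by
      rw [ContinuousMultilinearMap.compContinuousLinearMap_apply]
    rw [happ]
    exact per_order_ml hd'.1 (by omega) (iteratedFDeriv ℂ d Ψ₀ 0) _ B₀ B₁ hs0 hs1 ht0 hB₀ hB₁ hΔ (hK d hd) (hE d hd)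
  have hjet : ‖jet26 Ψ₁ (T B₁) - jet26 Ψ₀ B₀‖ ≤
      ∑ d ∈ Finset.Ico 2 7, ‖iteratedFDeriv ℂ d Ψ₁ 0 (fun _ => T B₁) - iteratedFDeriv ℂ d Ψ₀ 0 (fun _ => B₀)‖ := by
    unfold jet26
    rw [← Finset.sum_sub_distrib]
    refine (norm_sum_le _ _).trans (Finset.sum_le_sum fun d _ => ?_)
    rw [← smul_sub, norm_smul]
    calc ‖((d.factorial : ℂ))⁻¹‖ * ‖iteratedFDeriv ℂ d Ψ₁ 0 (fun _ => T B₁) - iteratedFDeriv ℂ d Ψ₀ 0 (fun _ => B₀)‖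
        ≤ 1 * ‖iteratedFDeriv ℂ d Ψ₁ 0 (fun _ => T B₁) - iteratedFDeriv ℂ d Ψ₀ 0 (fun _ => B₀)‖ :=
          mul_le_mul_of_nonneg_right (norm_inv_factorial_le_one d) (norm_nonneg _)
      _ = _ := one_mul _
  have hre : |(jet26 Ψ₁ (T B₁)).re - (jet26 Ψ₀ B₀).re| ≤
      ∑ d ∈ Finset.Ico 2 7, ((C_s * θ * x ^ 2) ^ 2 * (C * e * ρ) + 6 * (C_s * θ * x ^ 2) * (C_B * θ * x ^ 2 * ρ) * (C_E * e)) := by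
    rw [← Complex.sub_re]
    exact ((Complex.abs_re_le_norm _).trans hjet).trans (Finset.sum_le_sum hper)
  have hcard : (Finset.Ico 2 7).card = 5 := by rfl
  rw [Finset.sum_const, hcard, nsmul_eq_mul] at hre
  push_cast at hre
  have eq : e₁ + (jet26 Ψ₁ (T B₁)).re + R₁ - (e₀ + (jet26 Ψ₀ B₀).re + R₀) - (e₁ - e₀) =
      ((jet26 Ψ₁ (T B₁)).re - (jet26 Ψ₀ B₀).re) + (R₁ - R₀) := by ring
  rw [eq]
  have hM : 0 ≤ C_s ^ 2 * C + 6 * C_s * C_B * C_E :=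
    add_nonneg (mul_nonneg (sq_nonneg _) hC) (mul_nonneg (mul_nonneg (mul_nonneg (by norm_num) hCs) hCB) hCE)
  have hθ7 : 0 ≤ θ ^ 7 := pow_nonneg hθ 7
  have hRR : |R₁ - R₀| ≤ C_R * e * θ ^ 7 * x ^ 4 + C_R * e * θ ^ 7 * x ^ 4 :=
    (abs_sub R₁ R₀).trans (add_le_add hR₁ hR₀)
  calc |(jet26 Ψ₁ (T B₁)).re - (jet26 Ψ₀ B₀).re + (R₁ - R₀)|
      ≤ |(jet26 Ψ₁ (T B₁)).re - (jet26 Ψ₀ B₀).re| + |R₁ - R₀| := abs_add_le _ _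
    _ ≤ 5 * ((C_s * θ * x ^ 2) ^ 2 * (C * e * ρ) + 6 * (C_s * θ * x ^ 2) * (C_B * θ * x ^ 2 * ρ) * (C_E * e)) +
          (C_R * e * θ ^ 7 * x ^ 4 + C_R * e * θ ^ 7 * x ^ 4) := add_le_add hre hRR
    _ = 5 * (C_s ^ 2 * C + 6 * C_s * C_B * C_E) * e * x ^ 4 * (θ ^ 2 * ρ) + 2 * C_R * e * θ ^ 7 * x ^ 4 := by ring
    _ ≤ (5 * (C_s ^ 2 * C + 6 * C_s * C_B * C_E) + 2 * C_R) * e * x ^ 4 * (θ ^ 2 * ρ + θ ^ 7) := by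
          have hA : 0 ≤ 5 * (C_s ^ 2 * C + 6 * C_s * C_B * C_E) * e * x ^ 4 * θ ^ 7 := by positivity
          have hB : 0 ≤ 2 * C_R * e * x ^ 4 * (θ ^ 2 * ρ) := by positivity
          nlinarith [hA, hB]

end Algebra

/-! ### §3b The line's composition over the rows (proved) -/

section Composition

variable {𝕍 : Type} [NormedAddCommGroup 𝕍] [NormedSpace ℂ 𝕍] {F : T3Family} {γ : ℝ}

/-- **THE K1a INTERFACE COMPOSES (FIRST CHECKABLE STATEMENT, PROVED) — weighted form.**  Taylor structure over ONE chart family + flat-kernel Cauchy in operator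
norm (K1a) + kernel size + remainder + configuration size + configuration Cauchy with loss `ℓ ≥ 1` ⟹ the local two-cut-off row with slack `σ = 7` and rate
weight `w n = θ(n)²·ℓ(n)`, shifts `c := e′ − e` (vacuum constants), constant `5·(C_s²C + 6C_sC_BC_E) + 2C_R`, on a window with `(C_s + C_B)·θ(n) ≤ 1`.
[cite: King1986, Prop. 3.6 p.662, (3.42) p.660, (3.72) p.665; Balaban1985UV3, (30) p.263, (43)-(44) pp.266-267, (57) p.270] -/
theorem polymerCauchyMinAtTSlackW_of_charts {D : AlphaDataT3 F γ} {PT : TermFn F} {Φ : ChartFam 𝕍 F} {e : VacFam F} {B : CfgFam 𝕍 F}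
    {R : RemFam F} {b₀ p₀ κ a C C_E C_R C_s C_B : ℝ} {ℓ : ℕ → ℝ}
    (hC : 0 ≤ C) (hCE : 0 ≤ C_E) (hCR : 0 ≤ C_R) (hCs : 0 ≤ C_s) (hCB : 0 ≤ C_B) (hL : 1 ≤ (F.L : ℝ))
    (hθ0 : ∀ n, 0 ≤ θBal F.L γ b₀ p₀ n) (hθ1 : ∀ n, (C_s + C_B) * θBal F.L γ b₀ p₀ n ≤ 1) (hℓ : ∀ n, 1 ≤ ℓ n)
    (hT : TaylorSplitΦ PT Φ e B R) (hK : FlatKernelCauchyΦ D Φ κ a C) (hE : KernelSizeΦ D Φ κ C_E)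
    (hR : RemainderSmallΦ D R b₀ p₀ κ C_R) (hS : CfgSizeΦ D B b₀ p₀ C_s) (hBC : CfgCauchyΦ D B b₀ p₀ a C_B ℓ) :
    PolymerCauchyMinAtTSlackW D PT b₀ p₀ κ a 7 (5 * (C_s ^ 2 * C + 6 * C_s * C_B * C_E) + 2 * C_R)
      (fun n => θBal F.L γ b₀ p₀ n ^ 2 * ℓ n) := by
  refine ⟨fun K _ j Y => e (K + 1) (j + 1) (refineSet F K Y) - e K j Y, ?_⟩
  intro K n hn j hj V hV Y hY
  have hSz := hS K n hn j hj V hV Y hY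
  have hCy := hBC K n hn j hj V hV Y hY
  have hRm := hR K n hn j hj V hV Y hY
  have hEs := hE K (K - n) j Y hY
  rw [hT, hT]
  have hsθ : C_s * θBal F.L γ b₀ p₀ n ≤ 1 := by nlinarith [hθ1 n, hθ0 n]
  have hx0 : 0 ≤ ((F.L : ℝ) ^ (K - n - 1 - j))⁻¹ := by positivity
  have hx1 : ((F.L : ℝ) ^ (K - n - 1 - j))⁻¹ ≤ 1 := inv_le_one_of_one_le₀ (one_le_pow₀ hL)
  have hρ0 : 0 ≤ (((F.L : ℝ) ^ (1 + j))⁻¹) ^ a := Real.rpow_nonneg (by positivity) _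
  have hρ : 0 ≤ ℓ n * (((F.L : ℝ) ^ (1 + j))⁻¹) ^ a := mul_nonneg (zero_le_one.trans (hℓ n)) hρ0
  -- the loss-free kernel row implies the lossy one (`ℓ ≥ 1`)
  have hKc : ∀ d ∈ Finset.Ico 2 7, ‖kerT Φ K j Y d - ker Φ K j Y d‖ ≤
      C * Real.exp (-κ * D.treeLen K (1 + j) Y) * (ℓ n * (((F.L : ℝ) ^ (1 + j))⁻¹) ^ a) := by
    intro d hd
    refine (hK K (K - n) j Y hY d hd).trans ?_
    have hCe : 0 ≤ C * Real.exp (-κ * D.treeLen K (1 + j) Y) := mul_nonneg hC (Real.exp_pos _).le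
    calc C * Real.exp (-κ * D.treeLen K (1 + j) Y) * (((F.L : ℝ) ^ (1 + j))⁻¹) ^ a
        = C * Real.exp (-κ * D.treeLen K (1 + j) Y) * (1 * (((F.L : ℝ) ^ (1 + j))⁻¹) ^ a) := by rw [one_mul]
      _ ≤ C * Real.exp (-κ * D.treeLen K (1 + j) Y) * (ℓ n * (((F.L : ℝ) ^ (1 + j))⁻¹) ^ a) :=
          mul_le_mul_of_nonneg_left (mul_le_mul_of_nonneg_right (hℓ n) hρ0) hCe
  -- run `K+1`'s configuration is the transport of its pull-back
  set B₁ : PBond (F.P K) j → 𝕍 := fun c => B (K + 1) (K + 1 - n) (j + 1) (refineSet F K Y)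
    (fieldShift (F.sitesPerDir_eq (m := F.m) (K := K + 1) (j := K + 1 - n) (m' := F.m) (K' := n) (j' := 0) (by omega)) V)
    (matchBond F K j c) with hB₁
  have hpull : B (K + 1) (K + 1 - n) (j + 1) (refineSet F K Y)
      (fieldShift (F.sitesPerDir_eq (m := F.m) (K := K + 1) (j := K + 1 - n) (m' := F.m) (K' := n) (j' := 0) (by omega)) V) =
      transport 𝕍 F K j B₁ := (transport_pullback K j _).symm
  rw [hpull]
  have key := taylor_core_ml (transport 𝕍 F K j) (Φ K j Y) (Φ (K + 1) (j + 1) (refineSet F K Y)) _ B₁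
    (e K j Y) (e (K + 1) (j + 1) (refineSet F K Y)) _ _
    (hθ0 n) hsθ hx0 hx1 hρ (Real.exp_pos _).le hC hCE hCR hCs hCB hSz.1 hSz.2 hCy hKc hEs hRm.1 hRm.2
  -- reassociate `θ² * (ℓ * ρ₀)` as `(θ² * ℓ) * ρ₀`
  simpa only [mul_assoc] using key

/-- **THE ROW OF RECORD (loss-free configuration comparison, `ℓ ≡ 1`)**: the six rows ⟹ `PolymerCauchyMinAtTSlack D PT b₀ p₀ κ a 7 (5(C_s²C + 6C_sC_BC_E) + 2C_R)`
VERBATIM — feeds g11's `globalTwoRunSlackTail_of_polymerSlack` (with `PintDecompTrivT`, `LocCover`, `LocBlockVolume`, `LocMatched`, `TermSizeTrivT` of the same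
`(π, PT)`) ⟹ `∃ σ₀ C₀, 7 ≤ σ₀ ∧ 0 ≤ C₀ ∧ GlobalSupRateTSlack …` = the tail of STUB 3⁗ (and, by `GlobalSlackBeta.slackB_of_slack`, of its β-form).
[cite: King1986, Prop. 3.6 p.662, Thm 3.4 (3.9) p.656; Balaban1985UV3, (30) p.263, (43)-(44) pp.266-267, (57) p.270] -/
theorem polymerCauchyMinAtTSlack_of_charts {D : AlphaDataT3 F γ} {PT : TermFn F} {Φ : ChartFam 𝕍 F} {e : VacFam F} {B : CfgFam 𝕍 F}
    {R : RemFam F} {b₀ p₀ κ a C C_E C_R C_s C_B : ℝ}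
    (hC : 0 ≤ C) (hCE : 0 ≤ C_E) (hCR : 0 ≤ C_R) (hCs : 0 ≤ C_s) (hCB : 0 ≤ C_B) (hL : 1 ≤ (F.L : ℝ))
    (hθ0 : ∀ n, 0 ≤ θBal F.L γ b₀ p₀ n) (hθ1 : ∀ n, (C_s + C_B) * θBal F.L γ b₀ p₀ n ≤ 1)
    (hT : TaylorSplitΦ PT Φ e B R) (hK : FlatKernelCauchyΦ D Φ κ a C) (hE : KernelSizeΦ D Φ κ C_E)
    (hR : RemainderSmallΦ D R b₀ p₀ κ C_R) (hS : CfgSizeΦ D B b₀ p₀ C_s) (hBC : CfgCauchyΦ D B b₀ p₀ a C_B fun _ => 1) :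
    PolymerCauchyMinAtTSlack D PT b₀ p₀ κ a 7 (5 * (C_s ^ 2 * C + 6 * C_s * C_B * C_E) + 2 * C_R) := by
  obtain ⟨c, hc⟩ := polymerCauchyMinAtTSlackW_of_charts hC hCE hCR hCs hCB hL hθ0 hθ1 (fun _ => le_rfl) hT hK hE hR hS hBC
  exact ⟨c, fun K n hn j hj V hV Y hY => by simpa only [mul_one] using hc K n hn j hj V hV Y hY⟩

end Composition

/-! ### §3c PURE-FIRST (OWNER RULING g20-№11 ADDENDUM 3, of record: print's (43) activities are EXACT degree-2..6 polynomials, `R ≡ 0`; ideator 2's N8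
`polymerCauchyMinAtT_of_polySplit` in scalar currency) — the same interface yields the PURE row of record `T3AlphaInputsACTwoRunLevel.PolymerCauchyMinAtT` BY NAME
in the multilinear currency (append-only r2: nothing above is changed). -/

section Pure

variable {𝕍 : Type} [NormedAddCommGroup 𝕍] [NormedSpace ℂ 𝕍] {F : T3Family} {γ : ℝ}

/-- **POLYNOMIAL STRUCTURE ROW** (`TaylorSplitΦ` with `R ≡ 0`): the term IS the vacuum constant plus the retained jet — print's (33)/(43) read literally (N8.1/N8.2),
with `Φ` the near-truncated displayed chart polynomial. [cite: Balaban1985UV3, (33)-(34) p.264, (43) p.266] -/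
def PolySplitΦ (PT : TermFn F) (Φ : ChartFam 𝕍 F) (e : VacFam F) (B : CfgFam 𝕍 F) : Prop :=
  ∀ (K k b : ℕ) (Y : Set (Site (F.P K) 0)) (W : GaugeField (F.P K) k (Matrix.specialUnitaryGroup (Fin 2) ℂ)),
    PT K k (1 + b) Y W = e K b Y + (jet26 (Φ K b Y) (B K k b Y W)).re

/-- The retained-jet difference alone (no rest): `|Re jet26 Ψ₁ (T B₁) − Re jet26 Ψ₀ B₀| ≤ 5(C_s²C + 6C_sC_BC_E)·e·x⁴·θ²·ρ`. [cite: King1986, Prop. 3.6 p.662; Balaban1985UV3, (43)-(44) pp.266-267] -/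
theorem jet_re_diff_ml {E₀ E₁ : Type*} [NormedAddCommGroup E₀] [NormedSpace ℂ E₀] [NormedAddCommGroup E₁] [NormedSpace ℂ E₁]
    (T : E₀ →L[ℂ] E₁) (Ψ₀ : E₀ → ℂ) (Ψ₁ : E₁ → ℂ) (B₀ B₁ : E₀)
    {θ x ρ e C C_E C_s C_B : ℝ}
    (hθ : 0 ≤ θ) (hsθ : C_s * θ ≤ 1) (hx0 : 0 ≤ x) (hx1 : x ≤ 1) (hρ : 0 ≤ ρ) (he : 0 ≤ e)
    (hC : 0 ≤ C) (hCE : 0 ≤ C_E) (hCs : 0 ≤ C_s) (hCB : 0 ≤ C_B)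
    (hB₀ : ‖B₀‖ ≤ C_s * θ * x ^ 2) (hB₁ : ‖B₁‖ ≤ C_s * θ * x ^ 2) (hΔ : ‖B₁ - B₀‖ ≤ C_B * θ * x ^ 2 * ρ)
    (hK : ∀ d ∈ Finset.Ico 2 7,
      ‖(iteratedFDeriv ℂ d Ψ₁ 0).compContinuousLinearMap (fun _ => T) - iteratedFDeriv ℂ d Ψ₀ 0‖ ≤ C * e * ρ)
    (hE : ∀ d ∈ Finset.Ico 2 7, ‖iteratedFDeriv ℂ d Ψ₀ 0‖ ≤ C_E * e) :
    |(jet26 Ψ₁ (T B₁)).re - (jet26 Ψ₀ B₀).re| ≤ 5 * (C_s ^ 2 * C + 6 * C_s * C_B * C_E) * e * x ^ 4 * (θ ^ 2 * ρ) := by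
  have hx2 : x ^ 2 ≤ 1 := pow_le_one₀ hx0 hx1
  have hs0 : 0 ≤ C_s * θ * x ^ 2 := by positivity
  have hs1 : C_s * θ * x ^ 2 ≤ 1 := by
    calc C_s * θ * x ^ 2 ≤ 1 * 1 := mul_le_mul hsθ hx2 (by positivity) zero_le_one
      _ = 1 := one_mul 1
  have ht0 : 0 ≤ C_B * θ * x ^ 2 * ρ := by positivity
  have hper : ∀ d ∈ Finset.Ico 2 7,
      ‖iteratedFDeriv ℂ d Ψ₁ 0 (fun _ => T B₁) - iteratedFDeriv ℂ d Ψ₀ 0 (fun _ => B₀)‖ ≤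
        (C_s * θ * x ^ 2) ^ 2 * (C * e * ρ) + 6 * (C_s * θ * x ^ 2) * (C_B * θ * x ^ 2 * ρ) * (C_E * e) := by
    intro d hd
    have hd' := Finset.mem_Ico.mp hd
    have happ : iteratedFDeriv ℂ d Ψ₁ 0 (fun _ => T B₁) =
        ((iteratedFDeriv ℂ d Ψ₁ 0).compContinuousLinearMap fun _ => T) (fun _ => B₁) := by
      rw [ContinuousMultilinearMap.compContinuousLinearMap_apply]
    rw [happ]
    exact per_order_ml hd'.1 (by omega) (iteratedFDeriv ℂ d Ψ₀ 0) _ B₀ B₁ hs0 hs1 ht0 hB₀ hB₁ hΔ (hK d hd) (hE d hd)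
  have hjet : ‖jet26 Ψ₁ (T B₁) - jet26 Ψ₀ B₀‖ ≤
      ∑ d ∈ Finset.Ico 2 7, ‖iteratedFDeriv ℂ d Ψ₁ 0 (fun _ => T B₁) - iteratedFDeriv ℂ d Ψ₀ 0 (fun _ => B₀)‖ := by
    unfold jet26
    rw [← Finset.sum_sub_distrib]
    refine (norm_sum_le _ _).trans (Finset.sum_le_sum fun d _ => ?_)
    rw [← smul_sub, norm_smul]
    calc ‖((d.factorial : ℂ))⁻¹‖ * ‖iteratedFDeriv ℂ d Ψ₁ 0 (fun _ => T B₁) - iteratedFDeriv ℂ d Ψ₀ 0 (fun _ => B₀)‖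
        ≤ 1 * ‖iteratedFDeriv ℂ d Ψ₁ 0 (fun _ => T B₁) - iteratedFDeriv ℂ d Ψ₀ 0 (fun _ => B₀)‖ :=
          mul_le_mul_of_nonneg_right (norm_inv_factorial_le_one d) (norm_nonneg _)
      _ = _ := one_mul _
  have hre : |(jet26 Ψ₁ (T B₁)).re - (jet26 Ψ₀ B₀).re| ≤
      ∑ d ∈ Finset.Ico 2 7, ((C_s * θ * x ^ 2) ^ 2 * (C * e * ρ) + 6 * (C_s * θ * x ^ 2) * (C_B * θ * x ^ 2 * ρ) * (C_E * e)) := by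
    rw [← Complex.sub_re]
    exact ((Complex.abs_re_le_norm _).trans hjet).trans (Finset.sum_le_sum hper)
  have hcard : (Finset.Ico 2 7).card = 5 := by rfl
  rw [Finset.sum_const, hcard, nsmul_eq_mul] at hre
  push_cast at hre
  exact hre.trans (le_of_eq (by ring))

/-- **PURE-FIRST COMPOSITION (PROVED): the five rows (no rest, no loss) ⟹ the socket's PURE per-polymer row of record `PolymerCauchyMinAtT D PT b₀ p₀ κ a
(5(C_s²C + 6C_sC_BC_E))` BY NAME** — OWNER RULING g20-№11 ADDENDUM 3's line «K1a + CfgCauchy + sizes ⟹ PolymerCauchyMinAtT ⟹ slack_of_pure ⟹ g11 producer ⟹ 3⁗» in the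
multilinear currency; shifts `c := e′ − e`; window `(C_s + C_B)·θ(n) ≤ 1`. [cite: King1986, Prop. 3.6 p.662, Thm 3.4 (3.9) p.656; Balaban1985UV3, (33)-(34) p.264, (43)-(44) pp.266-267] -/
theorem polymerCauchyMinAtT_of_charts {D : AlphaDataT3 F γ} {PT : TermFn F} {Φ : ChartFam 𝕍 F} {e : VacFam F} {B : CfgFam 𝕍 F}
    {b₀ p₀ κ a C C_E C_s C_B : ℝ}
    (hC : 0 ≤ C) (hCE : 0 ≤ C_E) (hCs : 0 ≤ C_s) (hCB : 0 ≤ C_B) (hL : 1 ≤ (F.L : ℝ))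
    (hθ0 : ∀ n, 0 ≤ θBal F.L γ b₀ p₀ n) (hθ1 : ∀ n, (C_s + C_B) * θBal F.L γ b₀ p₀ n ≤ 1)
    (hP : PolySplitΦ PT Φ e B) (hK : FlatKernelCauchyΦ D Φ κ a C) (hE : KernelSizeΦ D Φ κ C_E)
    (hS : CfgSizeΦ D B b₀ p₀ C_s) (hBC : CfgCauchyΦ D B b₀ p₀ a C_B fun _ => 1) :
    PolymerCauchyMinAtT D PT b₀ p₀ κ a (5 * (C_s ^ 2 * C + 6 * C_s * C_B * C_E)) := by
  refine ⟨fun K _ j Y => e (K + 1) (j + 1) (refineSet F K Y) - e K j Y, ?_⟩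
  intro K n hn j hj V hV Y hY
  have hSz := hS K n hn j hj V hV Y hY
  have hCy := hBC K n hn j hj V hV Y hY
  have hEs := hE K (K - n) j Y hY
  rw [hP, hP]
  have hsθ : C_s * θBal F.L γ b₀ p₀ n ≤ 1 := by nlinarith [hθ1 n, hθ0 n]
  have hx0 : 0 ≤ ((F.L : ℝ) ^ (K - n - 1 - j))⁻¹ := by positivity
  have hx1 : ((F.L : ℝ) ^ (K - n - 1 - j))⁻¹ ≤ 1 := inv_le_one_of_one_le₀ (one_le_pow₀ hL)
  have hρ0 : 0 ≤ (((F.L : ℝ) ^ (1 + j))⁻¹) ^ a := Real.rpow_nonneg (by positivity) _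
  set B₁ : PBond (F.P K) j → 𝕍 := fun c => B (K + 1) (K + 1 - n) (j + 1) (refineSet F K Y)
    (fieldShift (F.sitesPerDir_eq (m := F.m) (K := K + 1) (j := K + 1 - n) (m' := F.m) (K' := n) (j' := 0) (by omega)) V)
    (matchBond F K j c) with hB₁
  have hpull : B (K + 1) (K + 1 - n) (j + 1) (refineSet F K Y)
      (fieldShift (F.sitesPerDir_eq (m := F.m) (K := K + 1) (j := K + 1 - n) (m' := F.m) (K' := n) (j' := 0) (by omega)) V) =
      transport 𝕍 F K j B₁ := (transport_pullback K j _).symm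
  rw [hpull]
  have hΔ : ‖B₁ - B K (K - n) j Y
      (fieldShift (F.sitesPerDir_eq (m := F.m) (K := K) (j := K - n) (m' := F.m) (K' := n) (j' := 0) (by omega)) V)‖ ≤
      C_B * θBal F.L γ b₀ p₀ n * (((F.L : ℝ) ^ (K - n - 1 - j))⁻¹) ^ 2 * (((F.L : ℝ) ^ (1 + j))⁻¹) ^ a := by
    simpa only [one_mul] using hCy
  have key := jet_re_diff_ml (transport 𝕍 F K j) (Φ K j Y) (Φ (K + 1) (j + 1) (refineSet F K Y)) _ B₁
    (hθ0 n) hsθ hx0 hx1 hρ0 (Real.exp_pos _).le hC hCE hCs hCB hSz.1 hSz.2 hΔ (hK K (K - n) j Y hY) hEs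
  have eq : e (K + 1) (j + 1) (refineSet F K Y) + (jet26 (Φ (K + 1) (j + 1) (refineSet F K Y)) (transport 𝕍 F K j B₁)).re -
      (e K j Y + (jet26 (Φ K j Y) (B K (K - n) j Y
        (fieldShift (F.sitesPerDir_eq (m := F.m) (K := K) (j := K - n) (m' := F.m) (K' := n) (j' := 0) (by omega)) V))).re) -
      (e (K + 1) (j + 1) (refineSet F K Y) - e K j Y) =
      (jet26 (Φ (K + 1) (j + 1) (refineSet F K Y)) (transport 𝕍 F K j B₁)).re -
      (jet26 (Φ K j Y) (B K (K - n) j Y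
        (fieldShift (F.sitesPerDir_eq (m := F.m) (K := K) (j := K - n) (m' := F.m) (K' := n) (j' := 0) (by omega)) V))).re := by ring
  rw [eq]
  exact key.trans (le_of_eq (by ring))

/-- `PolySplitΦ` is `TaylorSplitΦ` with the zero rest (so the slack compositions of §3b apply to a pure-first record too, `C_R = 0`). [folklore] -/
theorem taylorSplit_of_polySplit {PT : TermFn F} {Φ : ChartFam 𝕍 F} {e : VacFam F} {B : CfgFam 𝕍 F} (h : PolySplitΦ PT Φ e B) :
    TaylorSplitΦ PT Φ e B (fun _ _ _ _ _ => 0) := by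
  intro K k b Y W
  rw [h, add_zero]

end Pure

/-! ## §4 THE DISPLAY AUDIT of one run's step data (what `PkgAtV3`/`StepSeries` shows the interface, and what it does not)

Currency: the chart variable is the lane's OWN `𝓗 ∈ (PBond S.P b → 𝕍)` at every level (not print's B-monomials of (43)): then the chart family IS the displayed
`StepSeries.Ψ` (D1), the birth-level configurations ARE the displayed `StepSeries.Bcfg` (D2), [7]'s chart map `B ↦ 𝓗(B)` enters only the CONFIGURATION rows
(`CfgSizeΦ` ⇐ the displayed (28) `bound28` at the birth level; `CfgCauchyΦ` = the 19200-side two-run row about [7]-objects — F4 files p517074/p517569/p520930),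
and K1a (`FlatKernelCauchyΦ`) is a statement about the displayed `Ψ`'s of the two runs at MATCHED STEPS `b ↔ b+1` (identical running coupling and block
geometry; they differ only in the number of integrated levels beneath — [King1986] Props 3.6–3.8: dependence on the deep levels decays like `(L^{−b})^α`). -/

section Display

variable {L : ℕ} (S : Scales L) (G : Type) [GaugeGroup G] [MeasurableSpace G] [HaarData G]
  (𝕍 : Type) [NormedAddCommGroup 𝕍] [NormedSpace ℂ 𝕍] {N : ℕ → ℕ} [∀ k, NeZero (N k)]

/-- **(D1) THE CHARTS ARE DISPLAYED.**  The step-`b` charts `Ψ_X` of `StepSeries` (analytic on `ball 0 ρ` by the displayed row `chart` = G3D-01, gauge-invariant by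
`inv26`, identified with the new terms by `hPY`/`hPYZ`) ARE the chart family at chart index `b`, re-indexed by point-set domains (`setOf`, the geometry of
`tsys`/`ΩblkOf` — the pen's bookkeeping).  So the flat kernels `ker Φ K b Y d` of §0 are `jet26`'s own coefficients of displayed objects. [cite: Balaban1985UV3, (29)-(30) p.263] -/
def ChartsDisplayed (𝔖 : ∀ k, StepSeries S G 𝕍 (N k) k) (setOf : (k : ℕ) → (tsys 3 (N k)).Dom → Set (Site S.P 0))
    (Φrun : (b : ℕ) → Set (Site S.P 0) → ((PBond S.P b → 𝕍) → ℂ)) : Prop :=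
  ∀ (k : ℕ) (X : (tsys 3 (N k)).Dom), (𝔖 k).Ψ X = Φrun k (setOf k X)

/-- **(D2) THE BIRTH-LEVEL CONFIGURATIONS ARE DISPLAYED.**  At lattice level `k+1` the configuration at which the level-`(k+1)` (new) terms are read is the displayed
`Bcfg X triv U` ((27)/(28), size row `bound28`).  (At LATER lattice levels `k' > k+1` the same terms — now old — are read at `Bof k' k`, which `StepSeries` does NOT
carry as a field: (M3), DEFINABLE from the displayed composite minimisers `UkH` + [7]'s chart map + (27); a definition, not a gap.) [cite: Balaban1985UV3, (27)-(28) p.263] -/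
def BirthCfgDisplayed (𝔖 : ∀ k, StepSeries S G 𝕍 (N k) k) (setOf : (k : ℕ) → (tsys 3 (N k)).Dom → Set (Site S.P 0))
    (Bof : (k b : ℕ) → GaugeField S.P k G → Set (Site S.P 0) → (PBond S.P b → 𝕍)) : Prop :=
  ∀ (k : ℕ) (X : (tsys 3 (N k)).Dom) (U : GaugeField S.P (k + 1) G),
    (𝔖 k).Bcfg X (Hist.triv S.P (k + 1)) U = Bof (k + 1) k U (setOf k X)

variable {S G 𝕍} in
/-- The literal bridge from the displayed (α) row `hPY` to `TaylorSplitΦ`'s middle term at the birth level: under (D1)+(D2) the retained jet of `hPY` is the jet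
of the chart family at the configuration family. [cite: Balaban1985UV3, (30) p.263, (33) p.264] -/
theorem birth_jet_eq {𝔖 : ∀ k, StepSeries S G 𝕍 (N k) k} {setOf : (k : ℕ) → (tsys 3 (N k)).Dom → Set (Site S.P 0)}
    {Φrun : (b : ℕ) → Set (Site S.P 0) → ((PBond S.P b → 𝕍) → ℂ)}
    {Bof : (k b : ℕ) → GaugeField S.P k G → Set (Site S.P 0) → (PBond S.P b → 𝕍)}
    (hΦ : ChartsDisplayed S G 𝕍 𝔖 setOf Φrun) (hB : BirthCfgDisplayed S G 𝕍 𝔖 setOf Bof)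
    (k : ℕ) (X : (tsys 3 (N k)).Dom) (U : GaugeField S.P (k + 1) G) :
    jet26 ((𝔖 k).Ψ X) ((𝔖 k).Bcfg X (Hist.triv S.P (k + 1)) U) = jet26 (Φrun k (setOf k X)) (Bof (k + 1) k U (setOf k X)) := by
  rw [hΦ k X, hB k X U]

open Classical in
/-- **(M1) R-OLDFAC — THE ONE LOAD-BEARING (α)-SIDE OBJECT `StepSeries` DOES NOT DISPLAY.**  The previous-scale terms of (43) at step `k` (`StepSeries.oldVal`:
VALUE-ONLY data, constrained by the size row (44) `h44` and the degree floor `hfloor` alone) ARE the birth jets re-read at the transported configuration: for the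
terms born at step `b` (`oldVal` scale index `b+1 ≤ k`), summed over the `(y; n; c)`-indices localised in a domain `Y` (localiser `loc` = the geometry of
`Carriers.OldTerms`), `Σ oldVal(triv, U; b+1, y, n, c) = Re jet26(Φrun b Y)(Bof (k+1) b U Y) + Rfar` (far / dropped monomials, G3D-06-small).  Print: (43) «terms of
the form (33) … at U_k(h, U)»; the fluctuation corrections of old terms are booked as NEW terms ((45)–(47)), so the old kernels persist unchanged.  Absent this row
the old levels — every term level but the top one at lattice level `K − n` — have NO kernel objects in the package, and K1a cannot be stated about package data.
[cite: Balaban1985UV3, (43)-(44) pp.266-267, (45)-(47) p.267, (33) p.264] -/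
def OldTermsAreBirthJets (𝔖 : ∀ k, StepSeries S G 𝕍 (N k) k)
    (Φrun : (b : ℕ) → Set (Site S.P 0) → ((PBond S.P b → 𝕍) → ℂ))
    (Bof : (k b : ℕ) → GaugeField S.P k G → Set (Site S.P 0) → (PBond S.P b → 𝕍))
    (Rfar : (k b : ℕ) → Set (Site S.P 0) → GaugeField S.P k G → ℝ)
    (loc : (j : ℕ) → Site S.P j → (n : ℕ) → (Fin n → PBond S.P j) → Set (Site S.P 0)) : Prop :=
  ∀ (k b : ℕ), b + 1 ≤ k → ∀ (U : GaugeField S.P (k + 1) G) (Y : Set (Site S.P 0)),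
    (∑ y : Site S.P (b + 1), ∑ n ∈ Finset.range ((𝔖 k).Ndeg (b + 1) + 1), ∑ c : Fin n → PBond S.P (b + 1),
        if loc (b + 1) y n c = Y then (𝔖 k).oldVal (Hist.triv S.P (k + 1)) U (b + 1) y n c else 0) =
      (jet26 (Φrun b Y) (Bof (k + 1) b U Y)).re + Rfar (k + 1) b Y U

end Display

section Family

variable {F : T3Family} {𝔠 : AlphaConsts F.L (suGroupModel 2).N} {γ : ℝ} {hγ : 0 < γ} {hγ1 : γ ≤ (min 𝔠.gamma0 1) ^ 2}

/-- **A v3 FAMILY FACTORS THROUGH ONE CHART FAMILY** (the typed meaning of «a COHERENT admissible family», F-g4-1 §4): for every run `K` the family's step data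
satisfy (D1), (D2) and (M1) for the SAME `Φ K` (= its displayed charts), configurations `Bof K`, far remainders and localiser.  With it `TaylorSplitΦ` holds for the
term function read off `(Φ, Bof)` (birth level: `hPY`/`hPYZ` via `birth_jet_eq`; old levels: (M1)), and K1a `FlatKernelCauchyΦ D Φ κ a C` is a statement about the
family's displayed `Ψ`'s.  The `∃ p` of STUB 3⁗ is discharged only by such a family — a CONSTRUCTION (the canonical expansions of all runs from ONE recipe), not
obtainable from the per-`K` existential `OfV3At` (F-g4-1 §2); equivalently, a two-run DATA SCHEMA must carry (M1) and K1a at the family level.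
[cite: Balaban1985UV3, (29)-(30) p.263, (43) p.266; King1986, Thm 3.4 p.656, Prop. 3.6 p.662] -/
def FactorsThrough (p : ∀ K, AlphaInputsT3AC.PkgAtV3 F 𝔠 γ hγ hγ1 K) (Φ : ChartFam ↥(lieC (suGroupModel 2)) F)
    (setOf : (K k : ℕ) → (tsys 3 (nblkOf (T3Scales F γ hγ (hγ1.trans (sq_min_one_le _ 𝔠.gamma0_pos)) K) 𝔠.lane.carrier k)).Dom →
      Set (Site (F.P K) 0))
    (Bof : (K k b : ℕ) → GaugeField (F.P K) k (Matrix.specialUnitaryGroup (Fin 2) ℂ) → Set (Site (F.P K) 0) →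
      (PBond (F.P K) b → ↥(lieC (suGroupModel 2))))
    (Rfar : (K k b : ℕ) → Set (Site (F.P K) 0) → GaugeField (F.P K) k (Matrix.specialUnitaryGroup (Fin 2) ℂ) → ℝ)
    (loc : (K j : ℕ) → Site (F.P K) j → (n : ℕ) → (Fin n → PBond (F.P K) j) → Set (Site (F.P K) 0)) : Prop :=
  ∀ K : ℕ,
    ChartsDisplayed (T3Scales F γ hγ (hγ1.trans (sq_min_one_le _ 𝔠.gamma0_pos)) K) (Matrix.specialUnitaryGroup (Fin 2) ℂ)
        ↥(lieC (suGroupModel 2)) (fun k => (p K).𝔖 k) (setOf K) (Φ K) ∧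
      BirthCfgDisplayed (T3Scales F γ hγ (hγ1.trans (sq_min_one_le _ 𝔠.gamma0_pos)) K) (Matrix.specialUnitaryGroup (Fin 2) ℂ)
        ↥(lieC (suGroupModel 2)) (fun k => (p K).𝔖 k) (setOf K) (Bof K) ∧
      OldTermsAreBirthJets (T3Scales F γ hγ (hγ1.trans (sq_min_one_le _ 𝔠.gamma0_pos)) K) (Matrix.specialUnitaryGroup (Fin 2) ℂ)
        ↥(lieC (suGroupModel 2)) (fun k => (p K).𝔖 k) (Φ K) (Bof K) (Rfar K) (loc K)

/-- Under `FactorsThrough`, the family's displayed charts ARE `Φ` (projection; the object K1a speaks about). [cite: Balaban1985UV3, (29) p.263] -/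
theorem FactorsThrough.charts {p : ∀ K, AlphaInputsT3AC.PkgAtV3 F 𝔠 γ hγ hγ1 K} {Φ : ChartFam ↥(lieC (suGroupModel 2)) F}
    {setOf : (K k : ℕ) → (tsys 3 (nblkOf (T3Scales F γ hγ (hγ1.trans (sq_min_one_le _ 𝔠.gamma0_pos)) K) 𝔠.lane.carrier k)).Dom →
      Set (Site (F.P K) 0)}
    {Bof : (K k b : ℕ) → GaugeField (F.P K) k (Matrix.specialUnitaryGroup (Fin 2) ℂ) → Set (Site (F.P K) 0) →
      (PBond (F.P K) b → ↥(lieC (suGroupModel 2)))}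
    {Rfar : (K k b : ℕ) → Set (Site (F.P K) 0) → GaugeField (F.P K) k (Matrix.specialUnitaryGroup (Fin 2) ℂ) → ℝ}
    {loc : (K j : ℕ) → Site (F.P K) j → (n : ℕ) → (Fin n → PBond (F.P K) j) → Set (Site (F.P K) 0)}
    (h : FactorsThrough p Φ setOf Bof Rfar loc) (K k : ℕ)
    (X : (tsys 3 (nblkOf (T3Scales F γ hγ (hγ1.trans (sq_min_one_le _ 𝔠.gamma0_pos)) K) 𝔠.lane.carrier k)).Dom) :
    ((p K).𝔖 k).Ψ X = Φ K k (setOf K k X) :=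
  (h K).1 k X

end Family

end Summit.QuantumFields.YangMills.Cruxes.FluctuationComparisonRegPr.Ideate1ChartKernels
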